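import Literature.NumberTheory.Sieve.HeathBrownCubicPrimesHolds
import HarnessLib

/-!
# Heath-Brown's theorem on primes `x³ + 2y³` for EVERY large box exponent `c`, I: the Type II block

D. R. Heath-Brown, *Primes represented by `x³ + 2y³`*, Acta Math. 186 (2001) 1–84, Theorem 1 / (2.2):
`π(𝒜) = σ₀η²X²/(3 log X)·{1 + O((log log X)^{−1/6})}` with `η = (log X)^{−c}`.  The tree proves this for ONE
exponent `c` (`CubicPrimes.HeathBrown2001_primePairCount_asymptotic_holds`: the bookkeeping of p. 21 fixes
`c = 2c_* + 6`, `CubicSieve.HeathBrown2001_typeII_terms_of`).  The printed argument gives it for every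
`c ≥ 2c_* + 6`: all of Lemmas 3.4–3.10 are uniform in `η` on the range (2.1)
`exp(−(log X)^{1/3}) ≤ η ≤ 1`, and on p. 21 ("we then take `η = (log X)^{−2c₀}` and `Q₁ = (log X)^{600c₀}`")
the exponent of `η` enters (3.15) only through LOWER bounds — the one exponent identity
`1 − 5c/2 + c_* = −2c − 2` of the tree's proof becomes the inequality `c ≥ 2c_* + 6`, and `Q₁ = (log X)^A`
with `A = 160(2c + c_* + 4)` is defined from `c`.  This pure-proof file (no definitions, no named facts)
re-runs that bookkeeping with `c` free:

* `CubicSieve.HeathBrown2001_typeII_terms_allLargeC` (this file) — the Type II block of Lemma 3.4 is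
  `≪_c τη²X²/log X` for every `c ≥ c₀(σ₀)` (proof = `HeathBrown2001_typeII_terms_of` verbatim, fed with the
  tree's `HeathBrown2001_lemma_3_7/3_8/3_9/3_10_holds`, with the single change just described);
* the sequel `HeathBrownCubicPrimesAllLargeC` derives (2.4) and (2.2) for every `c ≥ c₀` with ONE `σ₀`.

Use: the `d = 1` rung ("admissible box exponents form an up-set") of the finite-uniform residue-class
version of the theorem (Heath-Brown–Moroz 2004, Thm 2) wanted by `Summits/Parity` (crux
`GoldbachHeathBrownDispersion.HeathBrownMorozUniform`): a finite maximum of thresholds over classes needs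
the all-large-`c` shape class by class, and this file shows the shape costs nothing at `d = 1`.

## References

* D. R. Heath-Brown, *Primes represented by `x³ + 2y³`*, Acta Math. 186 (2001) 1–84: Theorem 1, (2.2),
  (2.4), (3.15) and p. 21. [cite: HeathBrownActa2001, §3 (3.15) and p. 21]
* G. Harman, *Prime-Detecting Sieves* (2007), §13.2, (13.2.17): `η = (log X)^{−2c₀−2}`,
  `Q₁ = (log X)^{600(c₀+1)}` — any larger exponent works. [cite: Harman2007, §13.2 (13.2.17)]

## Mathlib / tree search

`lean search 'allLargeC|PrimePairCountUpset'`: nothing in Literature before this file. Tree (all PROVED):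
`HeathBrown2001_typeII_terms_of` and its tools `piece_bound`, `eventually_typeII_params`, `indexCount_le_log`,
`dyadicTop_add_one_le`, `dyadic_levels`, `abs_sum_sub_mul_sum_le`, `abs_sub_mul_le_three`,
`card_mIndexU_le_indexCount`, `card_mIndexCore_one_le_indexCount`, `sum_card_mIndexU2_le`,
`sum_card_mIndexU_le` (`HeathBrownCubicTypeIIProofs`); `eventually_params`, `sqrt_window_le`,
`HeathBrown2001_lemma_3_4` (`HeathBrownCubicSieveDecomposition(Proofs)`); the discharges
`HeathBrown2001_lemma_3_5/3_6/3_7/3_8/3_9/3_10_holds`, `HeathBrown2001_firstDegreePIT_holds`,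
`HeathBrown2001_singularProduct_holds`, `eventually_abs_normPrimeCount_sub_le`, `mainTerm_mul_loglog_isLittleO`.
-/

noncomputable section

open Polynomial NumberField Finset Filter Topology Asymptotics

namespace Literature.NumberTheory.Sieve.CubicSieve

open LFunctions.CubeRootTwoField CubicPrimes

/-! ### The Type II block for every large box exponent -/

set_option maxHeartbeats 800000 in
/-- **The Type II terms of Lemma 3.4 are `≪ τη²X²/log X` for EVERY box exponent `c ≥ c₀`** — the
bookkeeping of (3.15)/p. 21 (`HeathBrown2001_typeII_terms_of`) with the exponent free: for the limit
`σ₀` of the partial singular products there is `c₀ > 0` (namely `2c_* + 6`, `c_* = max(c₉, c₁₀, 0)` the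
exponents of Lemmas 3.9 and 3.10) such that for every `c ≥ c₀` there are `C, X₀` with, for `X ≥ X₀`,
`η = (log X)^{−c}`, `τ = (log log X)^{−1/6}`, `κ = σ₀η/(3X)`: the five groups `U₁^(1)`, `U₁^(2)`, `U^(n)`
(`n ≥ 3`), `U₂^(1)`, `S₄` of Lemma 3.4 total at most `C τη²X²/log X`.  The only place the proof of the
single-`c` version uses the VALUE of `c` is `L·η^{5/2}L^{c_*} = L^{−2c−2}`, which for `c ≥ 2c_* + 6`
becomes `≤`. [cite: HeathBrownActa2001, §3 (3.15) and p. 21] -/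
theorem HeathBrown2001_typeII_terms_allLargeC :
    ∀ σ₀ : ℝ, Tendsto singularProductPartial atTop (𝓝 σ₀) →
      ∃ c₀ : ℝ, 0 < c₀ ∧ ∀ c : ℝ, c₀ ≤ c → ∃ C X₀ : ℝ, ∀ X : ℝ, X₀ ≤ X →
        |(U1piece (boxPairs X (Real.log X ^ (-c))) pairIdeal X (hbTau (1 / 6) X) 1 : ℝ) -
            kappa σ₀ X (Real.log X ^ (-c)) *
              U1piece (normWindow X (Real.log X ^ (-c))) (fun J => J) X (hbTau (1 / 6) X) 1|
        + |(U1piece (boxPairs X (Real.log X ^ (-c))) pairIdeal X (hbTau (1 / 6) X) 2 : ℝ) -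
            kappa σ₀ X (Real.log X ^ (-c)) *
              U1piece (normWindow X (Real.log X ^ (-c))) (fun J => J) X (hbTau (1 / 6) X) 2|
        + ∑ n ∈ Icc 3 (chainBound (hbTau (1 / 6) X)),
            |(Upiece (boxPairs X (Real.log X ^ (-c))) pairIdeal X (hbTau (1 / 6) X) n : ℝ) -
              kappa σ₀ X (Real.log X ^ (-c)) *
                Upiece (normWindow X (Real.log X ^ (-c))) (fun J => J) X (hbTau (1 / 6) X) n|
        + |(U2one (boxPairs X (Real.log X ^ (-c))) pairIdeal X (hbTau (1 / 6) X) : ℝ) -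
            kappa σ₀ X (Real.log X ^ (-c)) *
              U2one (normWindow X (Real.log X ^ (-c))) (fun J => J) X (hbTau (1 / 6) X)|
        + |(S₄ (boxPairs X (Real.log X ^ (-c))) pairIdeal X (hbTau (1 / 6) X) : ℝ) -
            kappa σ₀ X (Real.log X ^ (-c)) *
              S₄ (normWindow X (Real.log X ^ (-c))) (fun J => J) X (hbTau (1 / 6) X)| ≤
          C * hbTau (1 / 6) X * (Real.log X ^ (-c)) ^ 2 * X ^ 2 / Real.log X := by
  intro σ₀ hσ
  have hσ0 : 0 ≤ σ₀ := ge_of_tendsto' hσ fun N => (singularProductPartial_pos N).le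
  obtain ⟨C₇, X₇, H7⟩ := HeathBrown2001_lemma_3_7_holds (1 / 6) (by norm_num) (by norm_num)
  obtain ⟨c₉, C₉, X₉, H9⟩ := HeathBrown2001_lemma_3_9_holds σ₀ hσ (1 / 6) (by norm_num) (by norm_num)
  obtain ⟨c₁₀, c₃, c₄, hc₃, hc₄, H10⟩ :=
    HeathBrown2001_lemma_3_10_holds (1 / 6) (by norm_num) (by norm_num)
  set cs := max (max c₉ c₁₀) 0 with hcs
  have hcs0 : 0 ≤ cs := le_max_right _ _
  have hc₉cs : c₉ ≤ cs := (le_max_left _ _).trans (le_max_left _ _)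
  have hc₁₀cs : c₁₀ ≤ cs := (le_max_right _ _).trans (le_max_left _ _)
  refine ⟨2 * cs + 6, by linarith, fun cη hcη => ?_⟩
  have hcη0 : 0 < cη := by linarith
  set A := 160 * (2 * cη + cs + 4) with hAdef
  have hA0 : 0 < A := by rw [hAdef]; linarith
  obtain ⟨C₁, c₁, X₈, hc₁, H8⟩ :=
    HeathBrown2001_lemma_3_8_holds (1 / 6) (by norm_num) (by norm_num) A c₃ c₄ hA0 hc₃ hc₄
  obtain ⟨C₁₀, X₁₀, H10'⟩ := H10 C₁ c₁ (1 / 2) 1 hc₁ (by norm_num) (by norm_num)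
  obtain ⟨X₀, hX₀⟩ := eventually_atTop.mp ((eventually_typeII_params hcη0 hA0).and
    ((eventually_ge_atTop X₇).and ((eventually_ge_atTop X₈).and
      ((eventually_ge_atTop X₉).and (eventually_ge_atTop X₁₀)))))
  refine ⟨5 * |C₇| * (1 + σ₀ / 3) + 5 * (|C₉| + |C₁₀|), X₀, fun X hX => ?_⟩
  obtain ⟨⟨hX2, hL8, hM, hη0, hη1, h21, hτ0, hτ4, hτL, hQ1, hQexp⟩, hX7, hX8, hX9, hX10⟩ :=
    hX₀ X hX
  -- abbreviations
  set L := Real.log X with hL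
  set η := L ^ (-cη) with hηdef
  set τ := hbTau (1 / 6) X with hτdef
  set κ := kappa σ₀ X η with hκ
  set Q₁ := L ^ A with hQ₁
  have hX1 : 1 < X := by linarith
  have hX0 : 0 < X := by linarith
  have hLpos : 0 < L := by linarith
  have hL1 : 1 ≤ L := by linarith
  have hκ0 : 0 ≤ κ := by rw [hκ, kappa]; positivity
  have hτ1 : τ ≤ 1 := by linarith
  -- the facts at this `X`
  obtain ⟨h7U, h7U1, h7U2, h7S4, h7V, h7UB, h7U1B, h7U2B, h7S4B, h7VB⟩ := H7 X η hX7 h21 hη1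
  have h9 := H9 X η hX9 h21 hη1
  have h8 := H8 X hX8
  have h10 := H10' X η Q₁ hX10 h21 hη1 hQ1 hQexp h8
  -- piece constants
  set B₉ := |C₉| * η ^ (5 / 2 : ℝ) * X ^ 2 * L ^ cs with hB₉
  set B₁₀ := |C₁₀| * X ^ 2 * Q₁ ^ (-(1 / 160 : ℝ)) * L ^ cs with hB₁₀
  set Bp := B₉ + ((dyadicTop X τ : ℕ) + 1) * B₁₀ with hBp
  have hQ₁pos : 0 < Q₁ := by positivity
  have hB₉0 : 0 ≤ B₉ := by positivity
  have hB₁₀0 : 0 ≤ B₁₀ := by positivity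
  have hBp0 : 0 ≤ Bp := by positivity
  -- the piece bound for every admissible `𝐦` and supported `c`
  have piece : ∀ (k : ℕ) (m : Fin k → ℕ), CoreAdmissible τ m → ∀ c : Ideal (𝓞 K) → ℝ,
      CSupport X τ c →
        |bilin (boxPairs X η) pairIdeal c (dWeight X τ m) -
            κ * bilin (normWindow X η) (fun J => J) c (dWeight X τ m)| ≤ Bp := by
    intro k m hm c hc
    refine piece_bound hX1 hτ0 hτ4 hm c ?_ ?_
    · refine (h9 k m hm c hc).trans ?_
      have hM1 := one_le_prod_of_coreAdmissible hτ0 hτ1 hm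
      have hMinv : (∏ i, (m i : ℝ))⁻¹ ≤ 1 := inv_le_one_of_one_le₀ hM1
      have hLc : L ^ c₉ ≤ L ^ cs := Real.rpow_le_rpow_of_exponent_le hL1 hc₉cs
      have hrest : 0 ≤ (∏ i, (m i : ℝ))⁻¹ * η ^ (5 / 2 : ℝ) * X ^ 2 * L ^ c₉ := by positivity
      calc C₉ * (∏ i, (m i : ℝ))⁻¹ * η ^ (5 / 2 : ℝ) * X ^ 2 * L ^ c₉
          = C₉ * ((∏ i, (m i : ℝ))⁻¹ * η ^ (5 / 2 : ℝ) * X ^ 2 * L ^ c₉) := by ring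
        _ ≤ |C₉| * ((∏ i, (m i : ℝ))⁻¹ * η ^ (5 / 2 : ℝ) * X ^ 2 * L ^ c₉) :=
            mul_le_mul_of_nonneg_right (le_abs_self _) hrest
        _ ≤ |C₉| * (1 * η ^ (5 / 2 : ℝ) * X ^ 2 * L ^ cs) := by gcongr
        _ = B₉ := by rw [hB₉]; ring
    · intro j hj
      obtain ⟨hVlo, hVhi⟩ := (dyadic_levels hX1 hτ4).1 j hj
      refine (h10 k m hm c hc _ hVlo hVhi).trans ?_
      have hLc : L ^ c₁₀ ≤ L ^ cs := Real.rpow_le_rpow_of_exponent_le hL1 hc₁₀cs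
      have hrest : 0 ≤ X ^ 2 * Q₁ ^ (-(1 / 160 : ℝ)) * L ^ c₁₀ := by positivity
      calc C₁₀ * X ^ 2 * Q₁ ^ (-(1 / 160 : ℝ)) * L ^ c₁₀
          = C₁₀ * (X ^ 2 * Q₁ ^ (-(1 / 160 : ℝ)) * L ^ c₁₀) := by ring
        _ ≤ |C₁₀| * (X ^ 2 * Q₁ ^ (-(1 / 160 : ℝ)) * L ^ c₁₀) :=
            mul_le_mul_of_nonneg_right (le_abs_self _) hrest
        _ ≤ |C₁₀| * (X ^ 2 * Q₁ ^ (-(1 / 160 : ℝ)) * L ^ cs) := by gcongr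
        _ = B₁₀ := by rw [hB₁₀]; ring
  -- the approximations compared piecewise: `|Ĝ(𝒜) − κĜ(ℬ)| ≤ #pieces · Bp`
  have gU : ∀ n, |Uhat X τ (boxPairs X η) pairIdeal n - κ * Uhat X τ (normWindow X η) (fun J => J) n| ≤
      #(mIndexU τ n) * Bp := by
    intro n
    unfold Uhat
    refine (abs_sum_sub_mul_sum_le _ _ _ (fun _ => Bp) κ fun m hm => ?_).trans
      (by rw [sum_const, nsmul_eq_mul])
    have hmU := (mem_mIndexU_iff hτ0).mp hm
    exact piece (n + 1) m hmU.1 _ (cSupport_cCoef (rpow_tau_le_rpow_last hX1.le hτ0 hmU.1))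
  have gS4 : |S4hat X τ (boxPairs X η) pairIdeal - κ * S4hat X τ (normWindow X η) (fun J => J)| ≤
      #(mIndexCore τ 1) * Bp := by
    unfold S4hat
    refine (abs_sum_sub_mul_sum_le _ _ _ (fun _ => Bp) κ fun m hm => ?_).trans
      (by rw [sum_const, nsmul_eq_mul])
    have hmc := (mem_mIndexCore_iff hτ0).mp hm
    exact piece 1 m hmc _ (cSupport_cCoef (rpow_tau_le_rpow_last (n := 0) hX1.le hτ0 hmc))
  have gV : |U2hat X τ (boxPairs X η) pairIdeal - κ * U2hat X τ (normWindow X η) (fun J => J)| ≤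
      (∑ nn ∈ nPairs τ, ∑ n ∈ range (u2Bound τ + 1), (#(mIndexU2 τ n nn.2) : ℝ)) * Bp := by
    unfold U2hat
    rw [sum_mul]
    refine abs_sum_sub_mul_sum_le _ _ _ _ κ fun nn hnn => ?_
    rw [sum_mul]
    refine abs_sum_sub_mul_sum_le _ _ _ _ κ fun n _ => ?_
    refine (abs_sum_sub_mul_sum_le _ _ _ (fun _ => Bp) κ fun m hm => ?_).trans
      (by rw [sum_const, nsmul_eq_mul])
    obtain ⟨hmc, -⟩ := (mem_mIndexU2_iff hτ0).mp hm
    obtain ⟨h₂, h₁₂, -, -⟩ := mem_nPairs hnn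
    exact piece _ m hmc _ (cSupport_c2Coef hX1.le hτ0 h₂ h₁₂.le)
  -- counts
  have hN : (indexCount τ : ℝ) ≤ L := indexCount_le_log hLpos hM
  have hJ : ((dyadicTop X τ : ℕ) : ℝ) + 1 ≤ L := dyadicTop_add_one_le hL8 hτ0.le hτ4
  have hNBp : (indexCount τ : ℝ) * Bp ≤ L * B₉ + L * L * B₁₀ := by
    calc (indexCount τ : ℝ) * Bp ≤ L * Bp := mul_le_mul_of_nonneg_right hN hBp0
      _ = L * B₉ + L * (((dyadicTop X τ : ℕ) : ℝ) + 1) * B₁₀ := by rw [hBp]; ring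
      _ ≤ L * B₉ + L * L * B₁₀ := by gcongr
  have gU' : ∀ n ≤ 2, |Uhat X τ (boxPairs X η) pairIdeal n -
      κ * Uhat X τ (normWindow X η) (fun J => J) n| ≤ L * B₉ + L * L * B₁₀ := fun n hn =>
    (gU n).trans ((mul_le_mul_of_nonneg_right (card_mIndexU_le_indexCount τ hn) hBp0).trans hNBp)
  have gS4' : |S4hat X τ (boxPairs X η) pairIdeal - κ * S4hat X τ (normWindow X η) (fun J => J)| ≤
      L * B₉ + L * L * B₁₀ :=
    gS4.trans ((mul_le_mul_of_nonneg_right (card_mIndexCore_one_le_indexCount τ) hBp0).trans hNBp)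
  have gV' : |U2hat X τ (boxPairs X η) pairIdeal - κ * U2hat X τ (normWindow X η) (fun J => J)| ≤
      L * B₉ + L * L * B₁₀ :=
    gV.trans ((mul_le_mul_of_nonneg_right (sum_card_mIndexU2_le τ) hBp0).trans hNBp)
  have gUsum : ∑ n ∈ Icc 3 (chainBound τ), |Uhat X τ (boxPairs X η) pairIdeal n -
      κ * Uhat X τ (normWindow X η) (fun J => J) n| ≤ L * B₉ + L * L * B₁₀ := by
    calc _ ≤ ∑ n ∈ Icc 3 (chainBound τ), (#(mIndexU τ n) : ℝ) * Bp := sum_le_sum fun n _ => gU n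
      _ = (∑ n ∈ Icc 3 (chainBound τ), (#(mIndexU τ n) : ℝ)) * Bp := by rw [sum_mul]
      _ ≤ (indexCount τ : ℝ) * Bp := mul_le_mul_of_nonneg_right (sum_card_mIndexU_le hτ0) hBp0
      _ ≤ _ := hNBp
  -- exponents: everything as powers of `L`
  set W := τ * X ^ 2 * L ^ (-2 * cη - 1) with hW
  have hW0 : 0 ≤ W := by positivity
  have hη2 : η ^ 2 = L ^ (-2 * cη) := by
    rw [hηdef, ← Real.rpow_natCast, ← Real.rpow_mul hLpos.le]; ring_nf
  have hF1 : η ^ 2 * X ^ 2 / L = X ^ 2 * L ^ (-2 * cη - 1) := by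
    rw [hη2, Real.rpow_sub hLpos, Real.rpow_one]; ring
  have hEA : C₇ * (hbXi τ / τ ^ 4) * (η ^ 2 * X ^ 2 / L) ≤ |C₇| * W := by
    have hξτ : hbXi τ / τ ^ 4 = τ := by
      rw [hbXi, div_eq_iff (pow_ne_zero 4 hτ0.ne')]; ring
    rw [hξτ, hF1, hW, show C₇ * τ * (X ^ 2 * L ^ (-2 * cη - 1)) = C₇ * (τ * X ^ 2 * L ^ (-2 * cη - 1)) by ring]
    exact mul_le_mul_of_nonneg_right (le_abs_self _) hW0
  have hEB : κ * (C₇ * (hbXi τ / τ ^ 4) * (η * X ^ 3 / L)) ≤ |C₇| * (σ₀ / 3) * W := by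
    have hξτ : hbXi τ / τ ^ 4 = τ := by
      rw [hbXi, div_eq_iff (pow_ne_zero 4 hτ0.ne')]; ring
    have hκη : κ * (η * X ^ 3 / L) = σ₀ / 3 * (η ^ 2 * X ^ 2 / L) := by
      rw [hκ, kappa]; field_simp
    calc κ * (C₇ * (hbXi τ / τ ^ 4) * (η * X ^ 3 / L)) = C₇ * τ * (κ * (η * X ^ 3 / L)) := by
          rw [hξτ]; ring
      _ = C₇ * (σ₀ / 3 * W) := by rw [hκη, hF1, hW]; ring
      _ ≤ |C₇| * (σ₀ / 3 * W) := mul_le_mul_of_nonneg_right (le_abs_self _) (by positivity)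
      _ = |C₇| * (σ₀ / 3) * W := by ring
  have hLB₉ : L * B₉ ≤ |C₉| * W := by
    -- `L · η^{5/2} L^{cs} = L^{1 − 5cη/2 + cs} ≤ L^{−2cη−2} = L^{−2cη−1} · L^{−1} ≤ L^{−2cη−1} τ`
    -- (the one place where `cη ≥ 2cs + 6` is used)
    have hη52 : η ^ (5 / 2 : ℝ) = L ^ (-cη * (5 / 2)) := by
      rw [hηdef, ← Real.rpow_mul hLpos.le]
    have hexp : L * η ^ (5 / 2 : ℝ) * L ^ cs ≤ L ^ (-2 * cη - 1) * L⁻¹ := by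
      rw [hη52, ← Real.rpow_neg_one, ← Real.rpow_add hLpos, show L * L ^ (-cη * (5 / 2)) * L ^ cs =
        L ^ (1 : ℝ) * L ^ (-cη * (5 / 2)) * L ^ cs by rw [Real.rpow_one], ← Real.rpow_add hLpos,
        ← Real.rpow_add hLpos]
      exact Real.rpow_le_rpow_of_exponent_le hL1 (by linarith)
    calc L * B₉ = |C₉| * X ^ 2 * (L * η ^ (5 / 2 : ℝ) * L ^ cs) := by rw [hB₉]; ring
      _ ≤ |C₉| * X ^ 2 * (L ^ (-2 * cη - 1) * L⁻¹) := by gcongr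
      _ ≤ |C₉| * X ^ 2 * (L ^ (-2 * cη - 1) * τ) := by gcongr
      _ = |C₉| * W := by rw [hW]; ring
  have hLB₁₀ : L * L * B₁₀ ≤ |C₁₀| * W := by
    have hQpow : Q₁ ^ (-(1 / 160 : ℝ)) = L ^ (A * (-(1 / 160))) := by
      rw [hQ₁, ← Real.rpow_mul hLpos.le]
    have hexp : L * L * Q₁ ^ (-(1 / 160 : ℝ)) * L ^ cs = L ^ (-2 * cη - 1) * L⁻¹ := by
      rw [hQpow, ← Real.rpow_neg_one, ← Real.rpow_add hLpos,
        show L * L * L ^ (A * (-(1 / 160))) * L ^ cs =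
          L ^ (1 : ℝ) * L ^ (1 : ℝ) * L ^ (A * (-(1 / 160))) * L ^ cs by rw [Real.rpow_one],
        ← Real.rpow_add hLpos, ← Real.rpow_add hLpos, ← Real.rpow_add hLpos]
      congr 1; rw [hAdef]; ring
    calc L * L * B₁₀ = |C₁₀| * X ^ 2 * (L * L * Q₁ ^ (-(1 / 160 : ℝ)) * L ^ cs) := by rw [hB₁₀]; ring
      _ = |C₁₀| * X ^ 2 * (L ^ (-2 * cη - 1) * L⁻¹) := by rw [hexp]
      _ ≤ |C₁₀| * X ^ 2 * (L ^ (-2 * cη - 1) * τ) := by gcongr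
      _ = |C₁₀| * W := by rw [hW]; ring
  -- the five groups
  have hII : L * B₉ + L * L * B₁₀ ≤ (|C₉| + |C₁₀|) * W := by linarith
  have tU1 := abs_sub_mul_le_three (U1piece (boxPairs X η) pairIdeal X τ 1 : ℝ)
    (U1piece (normWindow X η) (fun J => J) X τ 1 : ℝ) (Uhat X τ (boxPairs X η) pairIdeal 1)
    (Uhat X τ (normWindow X η) (fun J => J) 1) κ hκ0
  have tU2 := abs_sub_mul_le_three (U1piece (boxPairs X η) pairIdeal X τ 2 : ℝ)
    (U1piece (normWindow X η) (fun J => J) X τ 2 : ℝ) (Uhat X τ (boxPairs X η) pairIdeal 2)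
    (Uhat X τ (normWindow X η) (fun J => J) 2) κ hκ0
  have tS4 := abs_sub_mul_le_three (S₄ (boxPairs X η) pairIdeal X τ : ℝ)
    (S₄ (normWindow X η) (fun J => J) X τ : ℝ) (S4hat X τ (boxPairs X η) pairIdeal)
    (S4hat X τ (normWindow X η) (fun J => J)) κ hκ0
  have tV := abs_sub_mul_le_three (U2one (boxPairs X η) pairIdeal X τ : ℝ)
    (U2one (normWindow X η) (fun J => J) X τ : ℝ) (U2hat X τ (boxPairs X η) pairIdeal)
    (U2hat X τ (normWindow X η) (fun J => J)) κ hκ0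
  have tU : ∑ n ∈ Icc 3 (chainBound τ), |(Upiece (boxPairs X η) pairIdeal X τ n : ℝ) -
      κ * Upiece (normWindow X η) (fun J => J) X τ n| ≤
      ∑ n ∈ Icc 3 (chainBound τ), |(Upiece (boxPairs X η) pairIdeal X τ n : ℝ) -
          Uhat X τ (boxPairs X η) pairIdeal n| +
        κ * ∑ n ∈ Icc 3 (chainBound τ), |(Upiece (normWindow X η) (fun J => J) X τ n : ℝ) -
          Uhat X τ (normWindow X η) (fun J => J) n| +
        ∑ n ∈ Icc 3 (chainBound τ), |Uhat X τ (boxPairs X η) pairIdeal n -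
          κ * Uhat X τ (normWindow X η) (fun J => J) n| := by
    rw [mul_sum, ← sum_add_distrib, ← sum_add_distrib]
    exact sum_le_sum fun n _ => abs_sub_mul_le_three _ _ _ _ κ hκ0
  -- L3.7 bounds in terms of `W`
  have e1 := h7U1.trans hEA
  have e2 := h7U2.trans hEA
  have e3 := h7U.trans hEA
  have e4 := h7V.trans hEA
  have e5 := h7S4.trans hEA
  have f1 : κ * |(U1piece (normWindow X η) (fun J => J) X τ 1 : ℝ) -
      Uhat X τ (normWindow X η) (fun J => J) 1| ≤ |C₇| * (σ₀ / 3) * W :=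
    (mul_le_mul_of_nonneg_left h7U1B hκ0).trans hEB
  have f2 : κ * |(U1piece (normWindow X η) (fun J => J) X τ 2 : ℝ) -
      Uhat X τ (normWindow X η) (fun J => J) 2| ≤ |C₇| * (σ₀ / 3) * W :=
    (mul_le_mul_of_nonneg_left h7U2B hκ0).trans hEB
  have f3 : κ * ∑ n ∈ Icc 3 (chainBound τ), |(Upiece (normWindow X η) (fun J => J) X τ n : ℝ) -
      Uhat X τ (normWindow X η) (fun J => J) n| ≤ |C₇| * (σ₀ / 3) * W :=
    (mul_le_mul_of_nonneg_left h7UB hκ0).trans hEB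
  have f4 : κ * |(U2one (normWindow X η) (fun J => J) X τ : ℝ) -
      U2hat X τ (normWindow X η) (fun J => J)| ≤ |C₇| * (σ₀ / 3) * W :=
    (mul_le_mul_of_nonneg_left h7VB hκ0).trans hEB
  have f5 : κ * |(S₄ (normWindow X η) (fun J => J) X τ : ℝ) -
      S4hat X τ (normWindow X η) (fun J => J)| ≤ |C₇| * (σ₀ / 3) * W :=
    (mul_le_mul_of_nonneg_left h7S4B hκ0).trans hEB
  -- conclude
  have hgoal : (5 * |C₇| * (1 + σ₀ / 3) + 5 * (|C₉| + |C₁₀|)) * τ * η ^ 2 * X ^ 2 / L =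
      (5 * |C₇| * (1 + σ₀ / 3) + 5 * (|C₉| + |C₁₀|)) * W := by
    rw [hW, show τ * X ^ 2 * L ^ (-2 * cη - 1) = τ * (X ^ 2 * L ^ (-2 * cη - 1)) by ring, ← hF1]
    ring
  rw [hgoal]
  have g1 := (gU' 1 (by norm_num)).trans hII
  have g2 := (gU' 2 (by norm_num)).trans hII
  have g3 := gUsum.trans hII
  have g4 := gV'.trans hII
  have g5 := gS4'.trans hII
  linarith [tU1, tU2, tS4, tV, tU, e1, e2, e3, e4, e5, f1, f2, f3, f4, f5, g1, g2, g3, g4, g5]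

end Literature.NumberTheory.Sieve.CubicSieve

end
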